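import Summits.Ventures.YMGap.Thresholds.OneLinkLevelTwoQuad
import Summits.Ventures.YMGap.Thresholds.OneLinkLevelTwoRows
import HarnessLib

/-!
# Venture YMGap — the one-link modulus beyond first order, part 37: numerical ENVELOPES of `τ(N,R)`, of the A-part `√((1+ω⁺)/2)` and of
# the level-two modulus `K₂Q(N,R)` (inputs of the row files)

HONEST FRAMING: venture file of the cell `pub-ymgap` (QuantumFields programme), strong-coupling LATTICE statements for `SU(N)`
lattice Yang–Mills on `ℤ⁴` (Wilson action, tree coupling `N·x`, 't Hooft `x`); nothing about the continuum; no decay rate beyond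
`∃ c > 0`.  Pure real arithmetic, no number of record.  Feeding `oneLinkKRModulus_levelTwoQ` through ds-1's star door
`StarSUNLimit.star_massGapAt_of_oneLinkKRModulus` needs a numerical envelope of the modulus that is monotone in
`N ≥ N₀` and `R ≤ R₀` with rational parameters in place of the square roots; this file provides it:
* `tau_le`: `τ(N,R) ≤ R₀(b̄/2 + t)` for rationals `q ≥ √(R₀²/4 + 1/N₀²)`, `t ≥ √(b̄²/4 + c̄)`, `b̄ = R₀²(1+R₀/2+q)/(2−4/N₀²)`,
  `c̄ = R₀²(4/N₀² + 2(R₀/2+q)²)/(2−4/N₀²)`;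
* `sqrt_omegaPlus_le`: `√((1+ω⁺(N,R))/2) ≤ p` for `p ≥ √((1+ω̄⁺(N₀,R₀;q))/2)` (`c₁ ≤ (2N₀²−4)/(4N₀²−20)`, `c₂N ≤ 2N₀²/(4N₀²−20)`);
* `levelTwoQK_le`: `K₂Q(N,R) ≤ K̄₂Q(N₀,R₀;q,p,t)` (`C`, `E` decrease in `N`, every term increases in `R`).
The rows (`ImprovedThreshold 4 N (37/1000 | 81/2000 | 17/400 | 43/1000 | 87/2000)` for `N ≥ 4 | 6 | 10 | 20 | 50`) are the next file.
-/

noncomputable section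

open scoped Matrix ComplexConjugate BigOperators ContDiff Matrix.Norms.Frobenius
open Matrix Complex Finset MeasureTheory ProbabilityTheory
open Literature.MathematicalPhysics.QuantumFieldTheory
open Literature.MathematicalPhysics.QuantumFieldTheory.SUNBakryEmery
open Literature.MathematicalPhysics.QuantumFieldTheory.Balaban1983to89.StrongCouplingDobrushinWindow
open Literature.MathematicalPhysics.QuantumFieldTheory.Balaban1983to89.StrongCouplingKernelWindow

namespace Summit.Ventures.YMGap.OneLinkEigen

variable {N : ℕ}

section LevelTwoQRows

open Summit.Ventures.YMGap.StarSUNLimit (star_massGapAt_of_oneLinkKRModulus)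
open Summit.Ventures.YMGap.OneLinkEigenRows (casimirFactor_le)

/-- **Envelope of `τ(N,R)`**: for `N ≥ N₀ ≥ 3`, `0 ≤ R ≤ R₀`, rationals `q ≥ √(R₀²/4 + 1/N₀²)`, `t ≥ √(b̄²/4 + c̄)`:
`τ(N,R) ≤ R₀(b̄/2 + t)`. [folklore] -/
theorem tau_le {N₀ : ℕ} (hN₀ : 3 ≤ N₀) (hN : N₀ ≤ N) {R R₀ q t : ℝ} (hR0 : 0 ≤ R) (hRR₀ : R ≤ R₀)
    (hq : 0 ≤ q) (hq2 : R₀ ^ 2 / 4 + 1 / (N₀ : ℝ) ^ 2 ≤ q ^ 2) (ht : 0 ≤ t)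
    (ht2 : ((R₀) ^ 2 * (1 + (R₀) / 2 + (q)) / (2 - 4 / (N₀ : ℝ) ^ 2)) ^ 2 / 4 + ((R₀) ^ 2 * (4 / (N₀ : ℝ) ^ 2 + 2 * ((R₀) / 2 + (q)) ^ 2) / (2 - 4 / (N₀ : ℝ) ^ 2)) ≤ t ^ 2) :
    (R * ((R ^ 2 * (1 + R / 2 + Real.sqrt (R ^ 2 / 4 + 1 / (N : ℝ) ^ 2)) / (2 - 4 / (N : ℝ) ^ 2)) / 2 + Real.sqrt ((R ^ 2 * (1 + R / 2 + Real.sqrt (R ^ 2 / 4 + 1 / (N : ℝ) ^ 2)) / (2 - 4 / (N : ℝ) ^ 2)) ^ 2 / 4 + (R ^ 2 * (4 / (N : ℝ) ^ 2 + 2 * (R / 2 + Real.sqrt (R ^ 2 / 4 + 1 / (N : ℝ) ^ 2)) ^ 2) / (2 - 4 / (N : ℝ) ^ 2))))) ≤ ((R₀) * (((R₀) ^ 2 * (1 + (R₀) / 2 + (q)) / (2 - 4 / (N₀ : ℝ) ^ 2)) / 2 + (t))) := by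
  have h0 : (3 : ℝ) ≤ N₀ := by exact_mod_cast hN₀
  have h1 : (N₀ : ℝ) ≤ N := by exact_mod_cast hN
  have hNpos : (0 : ℝ) < N := by linarith
  have hN₀pos : (0 : ℝ) < N₀ := by linarith
  have hR₀0 : 0 ≤ R₀ := hR0.trans hRR₀
  have p2 : R ^ 2 ≤ R₀ ^ 2 := pow_le_pow_left₀ hR0 hRR₀ 2
  have hNN : (N₀ : ℝ) ^ 2 ≤ (N : ℝ) ^ 2 := pow_le_pow_left₀ hN₀pos.le h1 2
  have hinv : 1 / (N : ℝ) ^ 2 ≤ 1 / (N₀ : ℝ) ^ 2 := one_div_le_one_div_of_le (by positivity) hNN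
  have hinv4 : 4 / (N : ℝ) ^ 2 ≤ 4 / (N₀ : ℝ) ^ 2 :=
    div_le_div_of_nonneg_left (by norm_num) (by positivity) hNN
  have hs : Real.sqrt (R ^ 2 / 4 + 1 / (N : ℝ) ^ 2) ≤ q :=
    (Real.sqrt_le_sqrt (by linarith only [p2, hinv, hq2])).trans (le_of_eq (Real.sqrt_sq hq))
  have hs0 : 0 ≤ Real.sqrt (R ^ 2 / 4 + 1 / (N : ℝ) ^ 2) := Real.sqrt_nonneg _
  have hd₀ : 0 < 2 - 4 / (N₀ : ℝ) ^ 2 := by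
    have : (4 : ℝ) / (N₀ : ℝ) ^ 2 ≤ 4 / 9 := by
      rw [div_le_div_iff₀ (by positivity) (by norm_num)]; nlinarith only [h0]
    linarith only [this]
  have hdd : 2 - 4 / (N₀ : ℝ) ^ 2 ≤ 2 - 4 / (N : ℝ) ^ 2 := by linarith only [hinv4]
  have hd : 0 < 2 - 4 / (N : ℝ) ^ 2 := lt_of_lt_of_le hd₀ hdd
  -- b† ≤ b̄, c† ≤ c̄
  have hb : (R ^ 2 * (1 + R / 2 + Real.sqrt (R ^ 2 / 4 + 1 / (N : ℝ) ^ 2)) / (2 - 4 / (N : ℝ) ^ 2)) ≤ ((R₀) ^ 2 * (1 + (R₀) / 2 + (q)) / (2 - 4 / (N₀ : ℝ) ^ 2)) := by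
    refine div_le_div₀ (by positivity) ?_ hd₀ hdd
    exact mul_le_mul p2 (by linarith only [hRR₀, hs]) (by positivity) (by positivity)
  have hb0 : 0 ≤ (R ^ 2 * (1 + R / 2 + Real.sqrt (R ^ 2 / 4 + 1 / (N : ℝ) ^ 2)) / (2 - 4 / (N : ℝ) ^ 2)) := by positivity
  have hh : R / 2 + Real.sqrt (R ^ 2 / 4 + 1 / (N : ℝ) ^ 2) ≤ R₀ / 2 + q := by linarith only [hRR₀, hs]
  have hh0 : 0 ≤ R / 2 + Real.sqrt (R ^ 2 / 4 + 1 / (N : ℝ) ^ 2) := by positivity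
  have hhq : (R / 2 + Real.sqrt (R ^ 2 / 4 + 1 / (N : ℝ) ^ 2)) ^ 2 ≤ (R₀ / 2 + q) ^ 2 := pow_le_pow_left₀ hh0 hh 2
  have hc : (R ^ 2 * (4 / (N : ℝ) ^ 2 + 2 * (R / 2 + Real.sqrt (R ^ 2 / 4 + 1 / (N : ℝ) ^ 2)) ^ 2) / (2 - 4 / (N : ℝ) ^ 2)) ≤ ((R₀) ^ 2 * (4 / (N₀ : ℝ) ^ 2 + 2 * ((R₀) / 2 + (q)) ^ 2) / (2 - 4 / (N₀ : ℝ) ^ 2)) := by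
    refine div_le_div₀ (by positivity) ?_ hd₀ hdd
    exact mul_le_mul p2 (by linarith only [hhq, hinv4]) (by positivity) (by positivity)
  have hsq : Real.sqrt ((R ^ 2 * (1 + R / 2 + Real.sqrt (R ^ 2 / 4 + 1 / (N : ℝ) ^ 2)) / (2 - 4 / (N : ℝ) ^ 2)) ^ 2 / 4 + (R ^ 2 * (4 / (N : ℝ) ^ 2 + 2 * (R / 2 + Real.sqrt (R ^ 2 / 4 + 1 / (N : ℝ) ^ 2)) ^ 2) / (2 - 4 / (N : ℝ) ^ 2))) ≤ t := by
    have hb2 := pow_le_pow_left₀ hb0 hb 2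
    calc Real.sqrt ((R ^ 2 * (1 + R / 2 + Real.sqrt (R ^ 2 / 4 + 1 / (N : ℝ) ^ 2)) / (2 - 4 / (N : ℝ) ^ 2)) ^ 2 / 4 + (R ^ 2 * (4 / (N : ℝ) ^ 2 + 2 * (R / 2 + Real.sqrt (R ^ 2 / 4 + 1 / (N : ℝ) ^ 2)) ^ 2) / (2 - 4 / (N : ℝ) ^ 2))) ≤ Real.sqrt (t ^ 2) := Real.sqrt_le_sqrt (by linarith only [hb2, hc, ht2])
      _ = t := Real.sqrt_sq ht
  have hbr0 : 0 ≤ (R ^ 2 * (1 + R / 2 + Real.sqrt (R ^ 2 / 4 + 1 / (N : ℝ) ^ 2)) / (2 - 4 / (N : ℝ) ^ 2)) / 2 + Real.sqrt ((R ^ 2 * (1 + R / 2 + Real.sqrt (R ^ 2 / 4 + 1 / (N : ℝ) ^ 2)) / (2 - 4 / (N : ℝ) ^ 2)) ^ 2 / 4 + (R ^ 2 * (4 / (N : ℝ) ^ 2 + 2 * (R / 2 + Real.sqrt (R ^ 2 / 4 + 1 / (N : ℝ) ^ 2)) ^ 2) / (2 - 4 / (N : ℝ) ^ 2))) := by pos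itivity
  exact mul_le_mul hRR₀ (by linarith only [hb, hsq]) hbr0 hR₀0

/-- **Envelope of the A-part**: for `N ≥ N₀ ≥ 3`, `0 ≤ R ≤ R₀`, rationals `q ≥ √(R₀²/4 + 1/N₀²)`, `p ≥ √((1+ω̄⁺)/2)`:
`√((1+ω⁺(N,R))/2) ≤ p`. [folklore] -/
theorem sqrt_omegaPlus_le {N₀ : ℕ} (hN₀ : 3 ≤ N₀) (hN : N₀ ≤ N) {R R₀ q p : ℝ} (hR0 : 0 ≤ R) (hRR₀ : R ≤ R₀)
    (hq : 0 ≤ q) (hq2 : R₀ ^ 2 / 4 + 1 / (N₀ : ℝ) ^ 2 ≤ q ^ 2) (hp : 0 ≤ p)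
    (hp2 : (1 + ((2 * ((2 * (N₀ : ℝ) ^ 2 - 4) / (4 * (N₀ : ℝ) ^ 2 - 20)) * ((R₀) + ((R₀) ^ 2 / 2 + (R₀) * (q))) + 2 * (2 * (N₀ : ℝ) ^ 2 / (4 * (N₀ : ℝ) ^ 2 - 20)) * (((R₀) ^ 2 / 2 + (R₀) * (q)) + (R₀) * ((R₀) / 2 + (q)) ^ 2)))) / 2 ≤ p ^ 2) :
    Real.sqrt ((1 +
            (2 * ((N : ℝ) * (2 * (N : ℝ) - 4 / N) / ((2 * (N : ℝ) - 4 / N) ^ 2 - 4)) *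
            (R + (R ^ 2 / 2 + R * Real.sqrt (R ^ 2 / 4 + 1 / (N : ℝ) ^ 2)))
          + 2 * (2 * (N : ℝ) / ((2 * (N : ℝ) - 4 / N) ^ 2 - 4)) * N *
            ((R ^ 2 / 2 + R * Real.sqrt (R ^ 2 / 4 + 1 / (N : ℝ) ^ 2))
              + R * (R / 2 + Real.sqrt (R ^ 2 / 4 + 1 / (N : ℝ) ^ 2)) ^ 2))) / 2) ≤ p := by
  have h0 : (3 : ℝ) ≤ N₀ := by exact_mod_cast hN₀
  have h1 : (N₀ : ℝ) ≤ N := by exact_mod_cast hN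
  have hNpos : (0 : ℝ) < N := by linarith
  have hN₀pos : (0 : ℝ) < N₀ := by linarith
  have hR₀0 : 0 ≤ R₀ := hR0.trans hRR₀
  have p2 : R ^ 2 ≤ R₀ ^ 2 := pow_le_pow_left₀ hR0 hRR₀ 2
  have hinv : 1 / (N : ℝ) ^ 2 ≤ 1 / (N₀ : ℝ) ^ 2 :=
    one_div_le_one_div_of_le (by positivity) (pow_le_pow_left₀ hN₀pos.le h1 2)
  have hs : Real.sqrt (R ^ 2 / 4 + 1 / (N : ℝ) ^ 2) ≤ q :=
    (Real.sqrt_le_sqrt (by linarith only [p2, hinv, hq2])).trans (le_of_eq (Real.sqrt_sq hq))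
  have hs0 : 0 ≤ Real.sqrt (R ^ 2 / 4 + 1 / (N : ℝ) ^ 2) := Real.sqrt_nonneg _
  have hw : R ^ 2 / 2 + R * Real.sqrt (R ^ 2 / 4 + 1 / (N : ℝ) ^ 2) ≤ R₀ ^ 2 / 2 + R₀ * q := by
    have := mul_le_mul hRR₀ hs hs0 hR₀0
    linarith only [this, p2]
  set a : ℝ := 2 * (N : ℝ) - 4 / N with ha
  have hNa : (N : ℝ) * a = 2 * (N : ℝ) ^ 2 - 4 := by rw [ha]; field_simp
  have ha2 : a ^ 2 - 4 = 4 * (N : ℝ) ^ 2 - 20 + 16 / (N : ℝ) ^ 2 := by rw [ha]; field_simp; ring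
  have hD0 : (0 : ℝ) < 4 * (N : ℝ) ^ 2 - 20 := by nlinarith only [h0, h1]
  have hD₀0 : (0 : ℝ) < 4 * (N₀ : ℝ) ^ 2 - 20 := by nlinarith only [h0]
  have hDle : 4 * (N : ℝ) ^ 2 - 20 ≤ a ^ 2 - 4 := by
    rw [ha2]; exact le_add_of_nonneg_right (by positivity)
  have hden : 0 < a ^ 2 - 4 := lt_of_lt_of_le hD0 hDle
  have hNN : (N₀ : ℝ) ^ 2 ≤ (N : ℝ) ^ 2 := pow_le_pow_left₀ hN₀pos.le h1 2
  have hc1 : (N : ℝ) * a / (a ^ 2 - 4) ≤ (2 * (N₀ : ℝ) ^ 2 - 4) / (4 * (N₀ : ℝ) ^ 2 - 20) := by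
    rw [hNa]
    calc (2 * (N : ℝ) ^ 2 - 4) / (a ^ 2 - 4) ≤ (2 * (N : ℝ) ^ 2 - 4) / (4 * (N : ℝ) ^ 2 - 20) :=
          div_le_div_of_nonneg_left (by nlinarith only [h0, h1]) hD0 hDle
      _ ≤ (2 * (N₀ : ℝ) ^ 2 - 4) / (4 * (N₀ : ℝ) ^ 2 - 20) := by
          rw [div_le_div_iff₀ hD0 hD₀0]; nlinarith only [hNN]
  have hc2 : 2 * (N : ℝ) / (a ^ 2 - 4) * N ≤ 2 * (N₀ : ℝ) ^ 2 / (4 * (N₀ : ℝ) ^ 2 - 20) := by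
    have e : 2 * (N : ℝ) / (a ^ 2 - 4) * N = 2 * (N : ℝ) ^ 2 / (a ^ 2 - 4) := by ring
    rw [e]
    calc 2 * (N : ℝ) ^ 2 / (a ^ 2 - 4) ≤ 2 * (N : ℝ) ^ 2 / (4 * (N : ℝ) ^ 2 - 20) :=
          div_le_div_of_nonneg_left (by positivity) hD0 hDle
      _ ≤ 2 * (N₀ : ℝ) ^ 2 / (4 * (N₀ : ℝ) ^ 2 - 20) := by
          rw [div_le_div_iff₀ hD0 hD₀0]; nlinarith only [hNN]
  have hcb10 : 0 ≤ (2 * (N₀ : ℝ) ^ 2 - 4) / (4 * (N₀ : ℝ) ^ 2 - 20) := div_nonneg (by nlinarith only [h0]) hD₀0.le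
  have hcb20 : 0 ≤ 2 * (N₀ : ℝ) ^ 2 / (4 * (N₀ : ℝ) ^ 2 - 20) := div_nonneg (by positivity) hD₀0.le
  have hh : R / 2 + Real.sqrt (R ^ 2 / 4 + 1 / (N : ℝ) ^ 2) ≤ R₀ / 2 + q := by linarith only [hRR₀, hs]
  have hh0 : 0 ≤ R / 2 + Real.sqrt (R ^ 2 / 4 + 1 / (N : ℝ) ^ 2) := by positivity
  have hsq : (R / 2 + Real.sqrt (R ^ 2 / 4 + 1 / (N : ℝ) ^ 2)) ^ 2 ≤ (R₀ / 2 + q) ^ 2 := pow_le_pow_left₀ hh0 hh 2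
  have hRsq : R * (R / 2 + Real.sqrt (R ^ 2 / 4 + 1 / (N : ℝ) ^ 2)) ^ 2 ≤ R₀ * (R₀ / 2 + q) ^ 2 :=
    mul_le_mul hRR₀ hsq (by positivity) hR₀0
  have u1 : 2 * ((N : ℝ) * a / (a ^ 2 - 4)) * (R + (R ^ 2 / 2 + R * Real.sqrt (R ^ 2 / 4 + 1 / (N : ℝ) ^ 2))) ≤
      2 * ((2 * (N₀ : ℝ) ^ 2 - 4) / (4 * (N₀ : ℝ) ^ 2 - 20)) * (R₀ + (R₀ ^ 2 / 2 + R₀ * q)) :=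
    mul_le_mul (by linarith only [hc1]) (add_le_add hRR₀ hw) (by positivity) (by positivity)
  have u2 : 2 * (2 * (N : ℝ) / (a ^ 2 - 4)) * N *
        ((R ^ 2 / 2 + R * Real.sqrt (R ^ 2 / 4 + 1 / (N : ℝ) ^ 2)) + R * (R / 2 + Real.sqrt (R ^ 2 / 4 + 1 / (N : ℝ) ^ 2)) ^ 2) ≤
      2 * (2 * (N₀ : ℝ) ^ 2 / (4 * (N₀ : ℝ) ^ 2 - 20)) * ((R₀ ^ 2 / 2 + R₀ * q) + R₀ * (R₀ / 2 + q) ^ 2) := by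
    have e : 2 * (2 * (N : ℝ) / (a ^ 2 - 4)) * N = 2 * (2 * (N : ℝ) / (a ^ 2 - 4) * N) := by ring
    rw [e]
    exact mul_le_mul (by linarith only [hc2]) (add_le_add hw hRsq) (by positivity) (by positivity)
  calc Real.sqrt ((1 +
            (2 * ((N : ℝ) * (2 * (N : ℝ) - 4 / N) / ((2 * (N : ℝ) - 4 / N) ^ 2 - 4)) *
            (R + (R ^ 2 / 2 + R * Real.sqrt (R ^ 2 / 4 + 1 / (N : ℝ) ^ 2)))
          + 2 * (2 * (N : ℝ) / ((2 * (N : ℝ) - 4 / N) ^ 2 - 4)) * N *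
            ((R ^ 2 / 2 + R * Real.sqrt (R ^ 2 / 4 + 1 / (N : ℝ) ^ 2))
              + R * (R / 2 + Real.sqrt (R ^ 2 / 4 + 1 / (N : ℝ) ^ 2)) ^ 2))) / 2) ≤ Real.sqrt (p ^ 2) := Real.sqrt_le_sqrt (by linarith only [u1, u2, hp2])
    _ = p := Real.sqrt_sq hp

set_option maxHeartbeats 400000 in
/-- **Numerical envelope of `K₂Q(N,R)`**: for `N ≥ N₀ ≥ 3`, `0 ≤ R ≤ R₀ < 1/2` and rationals `q, p, t ≥ 0` with `q² ≥ R₀²/4 + 1/N₀²`,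
`p² ≥ (1 + ω̄⁺(N₀,R₀;q))/2`, `t² ≥ b̄²/4 + c̄`: `K₂Q(N,R) ≤ K̄₂Q(N₀,R₀;q,p,t)`. [folklore] -/
theorem levelTwoQK_le {N₀ : ℕ} (hN₀ : 3 ≤ N₀) (hN : N₀ ≤ N) {R R₀ q p t : ℝ} (hR0 : 0 ≤ R) (hRR₀ : R ≤ R₀) (hR₀ : R₀ < 1 / 2)
    (hq : 0 ≤ q) (hq2 : R₀ ^ 2 / 4 + 1 / (N₀ : ℝ) ^ 2 ≤ q ^ 2) (hp : 0 ≤ p)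
    (hp2 : (1 + ((2 * ((2 * (N₀ : ℝ) ^ 2 - 4) / (4 * (N₀ : ℝ) ^ 2 - 20)) * ((R₀) + ((R₀) ^ 2 / 2 + (R₀) * (q))) + 2 * (2 * (N₀ : ℝ) ^ 2 / (4 * (N₀ : ℝ) ^ 2 - 20)) * (((R₀) ^ 2 / 2 + (R₀) * (q)) + (R₀) * ((R₀) / 2 + (q)) ^ 2)))) / 2 ≤ p ^ 2) (ht : 0 ≤ t)
    (ht2 : ((R₀) ^ 2 * (1 + (R₀) / 2 + (q)) / (2 - 4 / (N₀ : ℝ) ^ 2)) ^ 2 / 4 + ((R₀) ^ 2 * (4 / (N₀ : ℝ) ^ 2 + 2 * ((R₀) / 2 + (q)) ^ 2) / (2 - 4 / (N₀ : ℝ) ^ 2)) ≤ t ^ 2) :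
    ((N : ℝ) ^ 2 / ((N : ℝ) ^ 2 - 1)) *
        (Real.sqrt ((1 +
            (2 * ((N : ℝ) * (2 * (N : ℝ) - 4 / N) / ((2 * (N : ℝ) - 4 / N) ^ 2 - 4)) *
            (R + (R ^ 2 / 2 + R * Real.sqrt (R ^ 2 / 4 + 1 / (N : ℝ) ^ 2)))
          + 2 * (2 * (N : ℝ) / ((2 * (N : ℝ) - 4 / N) ^ 2 - 4)) * N *
            ((R ^ 2 / 2 + R * Real.sqrt (R ^ 2 / 4 + 1 / (N : ℝ) ^ 2))
              + R * (R / 2 + Real.sqrt (R ^ 2 / 4 + 1 / (N : ℝ) ^ 2)) ^ 2))) / 2)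
          + ((N : ℝ) ^ 2 / (2 * ((N : ℝ) ^ 2 - 4))) * R + 2 * (((N : ℝ) ^ 2 / (2 * ((N : ℝ) ^ 2 - 4))) + 1 / 4) * (R ^ 2 / 2 + R * Real.sqrt (R ^ 2 / 4 + 1 / (N : ℝ) ^ 2))
          + (3 * ((N : ℝ) ^ 2 / (2 * ((N : ℝ) ^ 2 - 4))) * R ^ 2 + (2 * ((N : ℝ) ^ 2 / (2 * ((N : ℝ) ^ 2 - 4))) + 1 / 4) * (R * ((R ^ 2 * (1 + R / 2 + Real.sqrt (R ^ 2 / 4 + 1 / (N : ℝ) ^ 2)) / (2 - 4 / (N : ℝ) ^ 2)) / 2 + Real.sqrt ((R ^ 2 * (1 + R / 2 + Real.sqrt (R ^ 2 / 4 + 1 / (N : ℝ) ^ 2)) / (2 - 4 / (N : ℝ) ^ 2)) ^ 2 / 4 + (R ^ 2 * (4 / (N : ℝ) ^ 2 + 2 * (R / 2 + Real.sqrt (R ^ 2 / 4 + 1 / (N : ℝ) ^ 2)) ^ 2) / (2 - 4 / (N : ℝ) ^ 2)))))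
              + (10 * ((N : ℝ) ^ 2 / (2 * ((N : ℝ) ^ 2 - 4))) + 1 / 2) * R * (R ^ 2 / 2 + R * Real.sqrt (R ^ 2 / 4 + 1 / (N : ℝ) ^ 2))) / (1 / 2 - R)) ≤
      ((N₀ : ℝ) ^ 2 / ((N₀ : ℝ) ^ 2 - 1)) *
        ((p) + ((N₀ : ℝ) ^ 2 / (2 * ((N₀ : ℝ) ^ 2 - 4))) * (R₀) + 2 * (((N₀ : ℝ) ^ 2 / (2 * ((N₀ : ℝ) ^ 2 - 4))) + 1 / 4) * ((R₀) ^ 2 / 2 + (R₀) * (q))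
          + (3 * ((N₀ : ℝ) ^ 2 / (2 * ((N₀ : ℝ) ^ 2 - 4))) * (R₀) ^ 2 + (2 * ((N₀ : ℝ) ^ 2 / (2 * ((N₀ : ℝ) ^ 2 - 4))) + 1 / 4) * ((R₀) * (((R₀) ^ 2 * (1 + (R₀) / 2 + (q)) / (2 - 4 / (N₀ : ℝ) ^ 2)) / 2 + (t)))
              + (10 * ((N₀ : ℝ) ^ 2 / (2 * ((N₀ : ℝ) ^ 2 - 4))) + 1 / 2) * (R₀) * ((R₀) ^ 2 / 2 + (R₀) * (q))) / (1 / 2 - (R₀))) := by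
  have h0 : (3 : ℝ) ≤ N₀ := by exact_mod_cast hN₀
  have h1 : (N₀ : ℝ) ≤ N := by exact_mod_cast hN
  have hN4 : (0 : ℝ) < (N : ℝ) ^ 2 - 4 := by nlinarith only [h0, h1]
  have hN1 : (0 : ℝ) < (N : ℝ) ^ 2 - 1 := by nlinarith only [h0, h1]
  have hN4' : (0 : ℝ) < (N₀ : ℝ) ^ 2 - 4 := by nlinarith only [h0]
  have hN1' : (0 : ℝ) < (N₀ : ℝ) ^ 2 - 1 := by nlinarith only [h0]
  have hNpos : (0 : ℝ) < N := by linarith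
  have hN₀pos : (0 : ℝ) < N₀ := by linarith
  have hNne : (N : ℝ) ≠ 0 := hNpos.ne'
  have hC := casimirFactor_le (N₀ := N₀) (N := N) (by omega) hN
  have hE := levelTwoE_le hN₀ hN
  set C : ℝ := (N : ℝ) ^ 2 / ((N : ℝ) ^ 2 - 1) with hCdef
  set E : ℝ := (N : ℝ) ^ 2 / (2 * ((N : ℝ) ^ 2 - 4)) with hEdef
  set C₀ : ℝ := (N₀ : ℝ) ^ 2 / ((N₀ : ℝ) ^ 2 - 1) with hC₀def
  set E₀ : ℝ := (N₀ : ℝ) ^ 2 / (2 * ((N₀ : ℝ) ^ 2 - 4)) with hE₀def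
  have hC0 : 0 ≤ C := div_nonneg (by positivity) hN1.le
  have hC₀0 : 0 ≤ C₀ := div_nonneg (by positivity) hN1'.le
  have hE0 : 0 ≤ E := by positivity
  have hE₀0 : 0 ≤ E₀ := by positivity
  have hR₀0 : 0 ≤ R₀ := hR0.trans hRR₀
  have hT₀ : 0 < 1 / 2 - R₀ := by linarith
  have hT : 0 < 1 / 2 - R := by linarith
  have p2 : R ^ 2 ≤ R₀ ^ 2 := pow_le_pow_left₀ hR0 hRR₀ 2
  have hinv : 1 / (N : ℝ) ^ 2 ≤ 1 / (N₀ : ℝ) ^ 2 :=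
    one_div_le_one_div_of_le (by positivity) (pow_le_pow_left₀ hN₀pos.le h1 2)
  have hs : Real.sqrt (R ^ 2 / 4 + 1 / (N : ℝ) ^ 2) ≤ q :=
    (Real.sqrt_le_sqrt (by linarith only [p2, hinv, hq2])).trans (le_of_eq (Real.sqrt_sq hq))
  have hs0 : 0 ≤ Real.sqrt (R ^ 2 / 4 + 1 / (N : ℝ) ^ 2) := Real.sqrt_nonneg _
  have hw : R ^ 2 / 2 + R * Real.sqrt (R ^ 2 / 4 + 1 / (N : ℝ) ^ 2) ≤ R₀ ^ 2 / 2 + R₀ * q := by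
    have := mul_le_mul hRR₀ hs hs0 hR₀0
    linarith only [this, p2]
  have hw0 : 0 ≤ R ^ 2 / 2 + R * Real.sqrt (R ^ 2 / 4 + 1 / (N : ℝ) ^ 2) := by positivity
  have hwq0 : 0 ≤ R₀ ^ 2 / 2 + R₀ * q := by positivity
  have b0 : Real.sqrt ((1 +
            (2 * ((N : ℝ) * (2 * (N : ℝ) - 4 / N) / ((2 * (N : ℝ) - 4 / N) ^ 2 - 4)) *
            (R + (R ^ 2 / 2 + R * Real.sqrt (R ^ 2 / 4 + 1 / (N : ℝ) ^ 2)))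
          + 2 * (2 * (N : ℝ) / ((2 * (N : ℝ) - 4 / N) ^ 2 - 4)) * N *
            ((R ^ 2 / 2 + R * Real.sqrt (R ^ 2 / 4 + 1 / (N : ℝ) ^ 2))
              + R * (R / 2 + Real.sqrt (R ^ 2 / 4 + 1 / (N : ℝ) ^ 2)) ^ 2))) / 2) ≤ p := sqrt_omegaPlus_le hN₀ hN hR0 hRR₀ hq hq2 hp hp2
  -- the quadratic scale
  have htau := tau_le hN₀ hN hR0 hRR₀ hq hq2 ht ht2
  have htau0 : 0 ≤ (R * ((R ^ 2 * (1 + R / 2 + Real.sqrt (R ^ 2 / 4 + 1 / (N : ℝ) ^ 2)) / (2 - 4 / (N : ℝ) ^ 2)) / 2 + Real.sqrt ((R ^ 2 * (1 + R / 2 + Real.sqrt (R ^ 2 / 4 + 1 / (N : ℝ) ^ 2)) / (2 - 4 / (N : ℝ) ^ 2)) ^ 2 / 4 + (R ^ 2 * (4 / (N : ℝ) ^ 2 + 2 * (R / 2 + Real.sqrt (R ^ 2 / 4 + 1 / (N : ℝ) ^ 2)) ^ 2) / (2 - 4 / (N : ℝ) ^ 2))))) := tau_nonneg (by omega) hR0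
  -- the remaining terms
  have t1 : E * R ≤ E₀ * R₀ := mul_le_mul hE hRR₀ hR0 hE₀0
  have t2 : 2 * (E + 1 / 4) * (R ^ 2 / 2 + R * Real.sqrt (R ^ 2 / 4 + 1 / (N : ℝ) ^ 2)) ≤ 2 * (E₀ + 1 / 4) * (R₀ ^ 2 / 2 + R₀ * q) :=
    mul_le_mul (by linarith only [hE]) hw hw0 (by positivity)
  have n1 : 3 * E * R ^ 2 ≤ 3 * E₀ * R₀ ^ 2 := mul_le_mul (by linarith only [hE]) p2 (by positivity) (by positivity)
  have n2 : (10 * E + 1 / 2) * R * (R ^ 2 / 2 + R * Real.sqrt (R ^ 2 / 4 + 1 / (N : ℝ) ^ 2)) ≤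
      (10 * E₀ + 1 / 2) * R₀ * (R₀ ^ 2 / 2 + R₀ * q) :=
    mul_le_mul (mul_le_mul (by linarith only [hE]) hRR₀ hR0 (by positivity)) hw hw0 (by positivity)
  have n3 : (2 * E + 1 / 4) * (R * ((R ^ 2 * (1 + R / 2 + Real.sqrt (R ^ 2 / 4 + 1 / (N : ℝ) ^ 2)) / (2 - 4 / (N : ℝ) ^ 2)) / 2 + Real.sqrt ((R ^ 2 * (1 + R / 2 + Real.sqrt (R ^ 2 / 4 + 1 / (N : ℝ) ^ 2)) / (2 - 4 / (N : ℝ) ^ 2)) ^ 2 / 4 + (R ^ 2 * (4 / (N : ℝ) ^ 2 + 2 * (R / 2 + Real.sqrt (R ^ 2 / 4 + 1 / (N : ℝ) ^ 2)) ^ 2) / (2 - 4 / (N : ℝ) ^ 2))))) ≤ (2 * E₀ + 1 / 4) * ((R₀) * (((R₀) ^ 2 * (1 + (R₀) / 2 + (q)) / (2 - 4 / (N₀ : ℝ) ^ 2)) / 2 + (t))) :=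
    mul_le_mul (by linarith only [hE]) htau htau0 (by positivity)
  have htb0 : 0 ≤ ((R₀) * (((R₀) ^ 2 * (1 + (R₀) / 2 + (q)) / (2 - 4 / (N₀ : ℝ) ^ 2)) / 2 + (t))) := htau0.trans htau
  have hnum0 : 0 ≤ 3 * E₀ * R₀ ^ 2 + (2 * E₀ + 1 / 4) * ((R₀) * (((R₀) ^ 2 * (1 + (R₀) / 2 + (q)) / (2 - 4 / (N₀ : ℝ) ^ 2)) / 2 + (t))) + (10 * E₀ + 1 / 2) * R₀ * (R₀ ^ 2 / 2 + R₀ * q) := by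
    positivity
  have hfrac : (3 * E * R ^ 2 + (2 * E + 1 / 4) * (R * ((R ^ 2 * (1 + R / 2 + Real.sqrt (R ^ 2 / 4 + 1 / (N : ℝ) ^ 2)) / (2 - 4 / (N : ℝ) ^ 2)) / 2 + Real.sqrt ((R ^ 2 * (1 + R / 2 + Real.sqrt (R ^ 2 / 4 + 1 / (N : ℝ) ^ 2)) / (2 - 4 / (N : ℝ) ^ 2)) ^ 2 / 4 + (R ^ 2 * (4 / (N : ℝ) ^ 2 + 2 * (R / 2 + Real.sqrt (R ^ 2 / 4 + 1 / (N : ℝ) ^ 2)) ^ 2) / (2 - 4 / (N : ℝ) ^ 2)))))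
      + (10 * E + 1 / 2) * R * (R ^ 2 / 2 + R * Real.sqrt (R ^ 2 / 4 + 1 / (N : ℝ) ^ 2))) / (1 / 2 - R) ≤
      (3 * E₀ * R₀ ^ 2 + (2 * E₀ + 1 / 4) * ((R₀) * (((R₀) ^ 2 * (1 + (R₀) / 2 + (q)) / (2 - 4 / (N₀ : ℝ) ^ 2)) / 2 + (t))) + (10 * E₀ + 1 / 2) * R₀ * (R₀ ^ 2 / 2 + R₀ * q)) / (1 / 2 - R₀) :=
    div_le_div₀ hnum0 (by linarith only [n1, n2, n3]) hT₀ (by linarith only [hRR₀])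
  have hbody0 : 0 ≤ Real.sqrt ((1 +
            (2 * ((N : ℝ) * (2 * (N : ℝ) - 4 / N) / ((2 * (N : ℝ) - 4 / N) ^ 2 - 4)) *
            (R + (R ^ 2 / 2 + R * Real.sqrt (R ^ 2 / 4 + 1 / (N : ℝ) ^ 2)))
          + 2 * (2 * (N : ℝ) / ((2 * (N : ℝ) - 4 / N) ^ 2 - 4)) * N *
            ((R ^ 2 / 2 + R * Real.sqrt (R ^ 2 / 4 + 1 / (N : ℝ) ^ 2))
              + R * (R / 2 + Real.sqrt (R ^ 2 / 4 + 1 / (N : ℝ) ^ 2)) ^ 2))) / 2)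
      + E * R + 2 * (E + 1 / 4) * (R ^ 2 / 2 + R * Real.sqrt (R ^ 2 / 4 + 1 / (N : ℝ) ^ 2))
      + (3 * E * R ^ 2 + (2 * E + 1 / 4) * (R * ((R ^ 2 * (1 + R / 2 + Real.sqrt (R ^ 2 / 4 + 1 / (N : ℝ) ^ 2)) / (2 - 4 / (N : ℝ) ^ 2)) / 2 + Real.sqrt ((R ^ 2 * (1 + R / 2 + Real.sqrt (R ^ 2 / 4 + 1 / (N : ℝ) ^ 2)) / (2 - 4 / (N : ℝ) ^ 2)) ^ 2 / 4 + (R ^ 2 * (4 / (N : ℝ) ^ 2 + 2 * (R / 2 + Real.sqrt (R ^ 2 / 4 + 1 / (N : ℝ) ^ 2)) ^ 2) / (2 - 4 / (N : ℝ) ^ 2)))))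
        + (10 * E + 1 / 2) * R * (R ^ 2 / 2 + R * Real.sqrt (R ^ 2 / 4 + 1 / (N : ℝ) ^ 2))) / (1 / 2 - R) := by positivity
  exact mul_le_mul hC (by linarith only [b0, t1, t2, hfrac]) hbody0 hC₀0

end LevelTwoQRows

end Summit.Ventures.YMGap.OneLinkEigen
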